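import Mathlib
import HarnessLib
import Summits.QuantumFields.YangMills.Theses.PencilRigidity
import Summits.QuantumFields.YangMills.Theorems.PencilRigidityCurvatureKernelBoundTwoPointLocalBoundSemiDegenerate

/-!
# `CurvatureKernelBound` — stub B₂′ `SemiDegenerateLocalDecay` (support for stmt-QuantumFields-11687, line `sixteen-charts-analytic-kernel`, skeleton v15)

`W₁` + (factorising two-point function OR frequently bounded `c_k`) ⇒ the local two-point bounds
near the time axis with constants `A + B ≤ C s^(η − 10)`; here the constants are `s`-independent,
so `η = 10`, `C = ‖κ‖² + B`, `s₁ = 1`, `r₀ = s/2`.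

Route (identical to the landed B₂ `TwoPointLocalBoundSemiDegenerate`, only the export changes).
`S₁ 1 = κ∫` on real one-point tensors (translation clause of `W₁`,
`BoundedRenormalisation.exists_degreeOne_eq_const_mul_realIntegral`). For real `f 0, f 1` supported
in two disjoint closed balls of radius `r` the tensor `F = f 0 ⊗ f 1` is off-diagonal, and the
truncated part `S₁ 2 F − κ(∫ f 0) κ(∫ f 1)` is bounded by `B r⁸ M₀ M₁` (`|f i| ≤ M_i`):
* factorising branch: it vanishes (`B = 0`);
* bounded branch: along the subsequence `|c_k| ≤ M`, L1 `LatticeTruncatedTwoPointBound` and the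
  lattice point count (`SemiDegenerate.eventually_norm_truncated_le'`) bound the truncated lattice
  two-point function by `M² (2B_Q)² (3r)⁸ M₀ M₁` (`|tr F²| ≤ B_Q`), and the lattice tie of `W₁`
  at `n = 2, 1` passes this to the limit.
Hence `‖S₁ 2 F‖ ≤ ‖κ‖² (∫|f 0|)(∫|f 1|) + B r⁸ M₀ M₁`: `A = ‖κ‖²`, `C = A + B`,
`C s^(10 − 10) = C`. [folklore]
-/

noncomputable section

open scoped BigOperators Topology SchwartzMap ComplexConjugate InnerProductSpace
open MeasureTheory Filter Set Metric
open Literature.MathematicalPhysics.QuantumLattice Literature.MathematicalPhysics.AQFT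
open Literature.MathematicalPhysics.QuantumFieldTheory

namespace Summit.QuantumFields.YangMills.Theorems.CurvatureKernel

open SemiDegenerate BoundedRenormalisation in
/-- **Stub `SemiDegenerateLocalDecay`** (registered signature verbatim). `W₁` + (factorising
two-point function OR frequently bounded `c_k`) ⇒ the local two-point bounds near the time axis
with `A + B ≤ C s^(η − 10)`: `η = 10`, `s₁ = 1`, `r₀ = s/2`, `A = ‖κ‖²` (`S₁ 1 = κ∫`), `B = 0`
(factorising) resp. `B = M² (2B_Q)² 3⁸` (bounded `c_k`, via L1 and the lattice tie), `C = A + B`.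
See the module docstring. [folklore] -/
theorem SemiDegenerateLocalDecay : open Literature.MathematicalPhysics.QuantumLattice Literature.MathematicalPhysics.AQFT Literature.MathematicalPhysics.QuantumFieldTheory in ∀ (G : Type) [Group G] [TopologicalSpace G] [IsTopologicalGroup G] [CompactSpace G] [MeasurableSpace G] [BorelSpace G], IsCompactSimpleLieGroup G → ∀ (r : LatticeRep G) (sch : SpeciesScheme (YMSpecies G)) (S₁ : SchwingerFamily (EuclideanSpace ℝ (Fin 4))), ((∀ (n : ℕ), n ≠ 0 → ∀ (f : Fin n → SchwartzMap (EuclideanSpace ℝ (Fin 4)) ℝ) (F : SchwartzMap (Fin n → (EuclideanSpace ℝ (Fin 4))) ℂ), IsTensorOf F (fun i => ofRealTest (f i)) → IsOffDiagonal F → Filter.Tendsto (fun k : ℕ => ((latticeSchwinger r.ρ sch (fun s => s.F) k n (fun _ => r.curvature) f : ℝ) : ℂ)) Filter.atTop (nhds (S₁ n F))) ∧ (S₁.toLabelled.IsNormalized ∧ S₁.toLabelled.IsHermitian ∧ S₁.toLabelled.HasLinearGrowth ∧ S₁.toLabelled.IsReflectionPositive ∧ S₁.toLabelled.IsSymmetric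 ∧ S₁.toLabelled.HasClusterProperty) ∧ (∀ (n : ℕ) (a : (EuclideanSpace ℝ (Fin 4))) (F : SchwartzMap (Fin n → (EuclideanSpace ℝ (Fin 4))) ℂ), IsOffDiagonal F → S₁ n (translateMulti a F) = S₁ n F) ∧ (∀ (R : (EuclideanSpace ℝ (Fin 4)) ≃ₗᵢ[ℝ] (EuclideanSpace ℝ (Fin 4))), LinearMap.det (R.toLinearEquiv : (EuclideanSpace ℝ (Fin 4)) →ₗ[ℝ] (EuclideanSpace ℝ (Fin 4))) = 1 → (∀ i : Fin 4, ∃ j : Fin 4, R (EuclideanSpace.single i 1) = EuclideanSpace.single j 1 ∨ R (EuclideanSpace.single i 1) = -EuclideanSpace.single j 1) → ∀ (n : ℕ) (F : SchwartzMap (Fin n → (EuclideanSpace ℝ (Fin 4))) ℂ), IsOffDiagonal F → S₁ n (linActMulti R F) = S₁ n F) ∧ (∃ Δ : ℝ, 0 < Δ ∧ S₁.toLabelled.HasMassGap Δ ∧ HasLatticeMassGap r sch Δ)) → ((∀ (f : Fin 2 → SchwartzMap (EuclideanSpace ℝ (Fin 4)) ℝ) (F : SchwartzMap (Fin 2 →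 (EuclideanSpace ℝ (Fin 4))) ℂ) (F₀ F₁ : SchwartzMap (Fin 1 → (EuclideanSpace ℝ (Fin 4))) ℂ), IsTensorOf F (fun i => ofRealTest (f i)) → IsOffDiagonal F → IsTensorOf F₀ (fun _ => ofRealTest (f 0)) → IsTensorOf F₁ (fun _ => ofRealTest (f 1)) → S₁ 2 F = S₁ 1 F₀ * S₁ 1 F₁) ∨ (∃ M : ℝ, ∃ᶠ k in Filter.atTop, |sch.c r.curvature k| ≤ M)) → ∃ (C η s₁ : ℝ), 0 < η ∧ 0 < s₁ ∧ (∀ (s : ℝ), 0 < s → s < s₁ → ∃ (r₀ A B : ℝ), 0 < r₀ ∧ 0 ≤ A ∧ 0 ≤ B ∧ A + B ≤ C * s ^ (η - 10) ∧ (∀ (r : ℝ), 0 < r → r ≤ r₀ → ∀ (f : Fin 2 → SchwartzMap (EuclideanSpace ℝ (Fin 4)) ℝ) (F : SchwartzMap (Fin 2 → (EuclideanSpace ℝ (Fin 4))) ℂ) (M₀ M₁ : ℝ), IsTensorOf F (fun i => ofRealTest (f i)) → tsupport ((f 0 : SchwartzMap (EuclideanSpace ℝ (Fin 4)) ℝ)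 : (EuclideanSpace ℝ (Fin 4)) → ℝ) ⊆ Metric.closedBall (EuclideanSpace.single (0 : Fin 4) (-s)) r → tsupport ((f 1 : SchwartzMap (EuclideanSpace ℝ (Fin 4)) ℝ) : (EuclideanSpace ℝ (Fin 4)) → ℝ) ⊆ Metric.closedBall (EuclideanSpace.single (0 : Fin 4) s) r → (∀ x, |f 0 x| ≤ M₀) → (∀ x, |f 1 x| ≤ M₁) → ‖S₁ 2 F‖ ≤ A * (∫ x : (EuclideanSpace ℝ (Fin 4)), |f 0 x|) * (∫ x : (EuclideanSpace ℝ (Fin 4)), |f 1 x|) + B * r ^ 8 * M₀ * M₁)) := by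
  intro G _ _ _ _ _ _ _ r sch S₁ hW₁ halt
  obtain ⟨htie, -, htr, -, -⟩ := hW₁
  obtain ⟨κ, hκ⟩ := exists_degreeOne_eq_const_mul_realIntegral S₁ htr
  -- ### the truncated part is `O(r⁸ M₀ M₁)` on real tensors supported in disjoint `r`-balls
  obtain ⟨B, hB0, hB⟩ : ∃ B : ℝ, 0 ≤ B ∧ ∀ (c₀ c₁ : EuclideanSpace ℝ (Fin 4)) (ρ : ℝ), 0 < ρ →
      Disjoint (closedBall c₀ ρ) (closedBall c₁ ρ) →
      ∀ (f : Fin 2 → 𝓢(EuclideanSpace ℝ (Fin 4), ℝ)) (F : 𝓢((Fin 2 → EuclideanSpace ℝ (Fin 4)), ℂ))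
        (M₀ M₁ : ℝ), IsTensorOf F (fun i => ofRealTest (f i)) →
        tsupport (f 0 : EuclideanSpace ℝ (Fin 4) → ℝ) ⊆ closedBall c₀ ρ →
        tsupport (f 1 : EuclideanSpace ℝ (Fin 4) → ℝ) ⊆ closedBall c₁ ρ →
        (∀ x, |f 0 x| ≤ M₀) → (∀ x, |f 1 x| ≤ M₁) →
        ‖S₁ 2 F - κ * ((∫ x : EuclideanSpace ℝ (Fin 4), f 0 x : ℝ) : ℂ) *
            (κ * ((∫ x : EuclideanSpace ℝ (Fin 4), f 1 x : ℝ) : ℂ))‖ ≤ B * ρ ^ 8 * M₀ * M₁ := by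
    rcases halt with hfac | hM
    · -- factorising branch: the truncated part vanishes
      refine ⟨0, le_rfl, ?_⟩
      intro c₀ c₁ ρ hρ hdisj f F M₀ M₁ hF h0 h1 hM₀ hM₁
      have hFoff : IsOffDiagonal F := isOffDiagonal_of_isTensorOf_of_disjoint hF (hdisj.mono h0 h1)
      obtain ⟨F₀, hF₀⟩ := exists_isTensorOf (n := 1) (fun _ : Fin 1 => ofRealTest (f 0))
      obtain ⟨F₁, hF₁⟩ := exists_isTensorOf (n := 1) (fun _ : Fin 1 => ofRealTest (f 1))
      rw [hfac f F F₀ F₁ hF hFoff hF₀ hF₁, hκ (f 0) F₀ hF₀, hκ (f 1) F₁ hF₁, sub_self, norm_zero]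
      simp
    · -- bounded branch: L1 along the bounded subsequence, then the lattice tie
      obtain ⟨M, hM⟩ := hM
      obtain ⟨BQ, hBQ⟩ := r.curvature.bounded
      obtain ⟨φ, hφmono, hφM⟩ := Filter.extraction_of_frequently_atTop hM
      have hφa : Tendsto (fun j => sch.a (φ j)) atTop (𝓝 0) :=
        sch.tendsto_a.comp hφmono.tendsto_atTop
      refine ⟨M ^ 2 * (2 * BQ) ^ 2 * 3 ^ 8, by positivity, ?_⟩
      intro c₀ c₁ ρ hρ hdisj f F M₀ M₁ hF h0 h1 hM₀ hM₁
      have hFoff : IsOffDiagonal F := isOffDiagonal_of_isTensorOf_of_disjoint hF (hdisj.mono h0 h1)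
      obtain ⟨F₀, hF₀⟩ := exists_isTensorOf (n := 1) (fun _ : Fin 1 => ofRealTest (f 0))
      obtain ⟨F₁, hF₁⟩ := exists_isTensorOf (n := 1) (fun _ : Fin 1 => ofRealTest (f 1))
      have hLk := fun k => LatticeTruncatedTwoPointBound G r sch r.curvature BQ hBQ k f
      have hlat := eventually_norm_truncated_le' hρ h0 h1 hM₀ hM₁ sch.a_pos hφa hφM hLk
      have hu := (htie 2 two_ne_zero f F hF hFoff).comp hφmono.tendsto_atTop
      have hv := (htie 1 one_ne_zero (fun _ => f 0) F₀ hF₀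
        (HypercubicLimit.Negative.isOffDiagonal_fin_one F₀)).comp hφmono.tendsto_atTop
      have hw := (htie 1 one_ne_zero (fun _ => f 1) F₁ hF₁
        (HypercubicLimit.Negative.isOffDiagonal_fin_one F₁)).comp hφmono.tendsto_atTop
      have hZ : ‖S₁ 2 F - S₁ 1 F₀ * S₁ 1 F₁‖ ≤
          M ^ 2 * (2 * BQ) ^ 2 * ((3 * ρ) ^ 4 * M₀) * ((3 * ρ) ^ 4 * M₁) :=
        le_of_tendsto (hu.sub (hv.mul hw)).norm hlat
      rw [hκ (f 0) F₀ hF₀, hκ (f 1) F₁ hF₁] at hZ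
      exact hZ.trans (le_of_eq (by ring))
  -- ### the local bounds: `C = ‖κ‖² + B`, `η = 10`, `s₁ = 1`; `r₀ = s/2`, `A = ‖κ‖²`
  refine ⟨‖κ‖ ^ 2 + B, 10, 1, by norm_num, one_pos, fun s hs _ => ?_⟩
  refine ⟨s / 2, ‖κ‖ ^ 2, B, half_pos hs, sq_nonneg _, hB0, ?_, ?_⟩
  · rw [show (10 : ℝ) - 10 = 0 by norm_num, Real.rpow_zero, mul_one]
  · intro ρ hρ hρs f F M₀ M₁ hF h0 h1 hM₀ hM₁
    have key := hB _ _ ρ hρ (disjoint_closedBall_single hs hρs) f F M₀ M₁ hF h0 h1 hM₀ hM₁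
    calc ‖S₁ 2 F‖ ≤ ‖κ * ((∫ x : EuclideanSpace ℝ (Fin 4), f 0 x : ℝ) : ℂ) *
          (κ * ((∫ x : EuclideanSpace ℝ (Fin 4), f 1 x : ℝ) : ℂ))‖ +
        ‖S₁ 2 F - κ * ((∫ x : EuclideanSpace ℝ (Fin 4), f 0 x : ℝ) : ℂ) *
          (κ * ((∫ x : EuclideanSpace ℝ (Fin 4), f 1 x : ℝ) : ℂ))‖ := norm_le_insert' _ _
      _ ≤ ‖κ‖ ^ 2 * (∫ x : EuclideanSpace ℝ (Fin 4), |f 0 x|) * (∫ x : EuclideanSpace ℝ (Fin 4), |f 1 x|) +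
          B * ρ ^ 8 * M₀ * M₁ := add_le_add (norm_disconnected_le κ f) key

end Summit.QuantumFields.YangMills.Theorems.CurvatureKernel

end
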